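import Summits.MatrixMultiplication.MatrixMultiplication.Theorems.AbelianSTPPCensusFPQThree

/-!
# Rule FPq at `p = 3` («FP3»): the two-letter structure theorem

Cell mm-stpp (rung F-M1), theory lane «past the walls» (seat mm-stpp-theory, gen 19).  Census-silent STRUCTURE file, sequel of
`AbelianSTPPCensusFPQThree`; HOME/mm-stpp-theory/FP3-NOTE.md.

The three letter forms of `FPQ.AdmG Λ (3·|Λ|) a b c` (form B `X, Y → Z′`, form A `−Z′, X → −Y`, form C `Y, −Z′ → −X`) are read jointly.
Writing `q = |Λ|`, `S_X = Σ a b`, `S_Y = Σ b c`, `S_W = Σ c a` and `β_A, β_B, β_C` for the caps `max a, max b, max c`: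
* `three_supports_le_of_full_X / _Y / _W` — a FULL class of one letter (a coset of the order-`3` subgroup inside that set) forces the class
  supports of the OTHER two letters to total at most `q + 3·β` (`β` = the cap of the form whose target the full letter is):
  `x` full ⇒ `#supp y + #supp z ≤ q + 3β_C`; `y` full ⇒ `#supp z + #supp x ≤ q + 3β_A`; `z` full ⇒ `#supp x + #supp y ≤ q + 3β_B`;
* **`three_two_letters_full`** — if `q < S_W`, `2q + 6β_B < S_X + S_Y`, `2q + 6β_A < S_X + S_W` and `2q + 6β_C < S_Y + S_W`, then at least TWO
  of the three letters have a full class (one letter alone cannot carry the full classes: the other two would be `{0,1,2}`-valued, hence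
  supported on at least half their mass, contradicting the support bound above; no full class at all is `three_exists_full`);
* **`admG_three_structure`** — the same read on `AdmG Λ M a b c` at `M = 3q`.
At the T_B wall list of record `7128 = 3·2376` (`(14,17,18)+(16,16,16)⁸+(14,15,15)`: `S = 2496 / 2579 / 2510`, caps `16 / 17 / 18`) and at
`(7,7,7)⁵ @ 648 = 3·216` all four hypotheses hold (`decide` on the shape data, not done here), so every FP3-admissible split there has full
classes in two letters and two of the three support sums are `≤ q + 3β` — the histogram-level content of FP3 is thereby exhausted
(FP3-NOTE §4 exhibits value histograms passing every count); what remains is positional.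
WHAT THIS IS NOT: no kill, no certificate, no census number, no `ω` statement; statements about the shape-level predicate only.
-/

set_option linter.dupNamespace false -- `MatrixMultiplication.MatrixMultiplication` (summit = problem, D-0017)
set_option autoImplicit false

namespace Summit.MatrixMultiplication.MatrixMultiplication.Theorems

open Finset

namespace FPQ

variable {Λ : Type} [AddCommGroup Λ] [Fintype Λ]

/-- Re-indexing a class count along `g ↦ −g`: `#{g : P (f (−g))} = #{g : P (f g)}`. [bookkeeping] -/
theorem card_filter_comp_neg (f : Λ → ℕ) (P : ℕ → Prop) [DecidablePred P] :
    (univ.filter (fun g => P (f (-g)))).card = (univ.filter (fun g => P (f g))).card := by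
  rw [card_filter, card_filter]
  exact Equiv.sum_comp (Equiv.neg Λ) (fun g => if P (f g) then 1 else 0)

omit [AddCommGroup Λ] in
/-- A `{0,1,2}`-valued class count is supported on at least half its mass: `Σ u ≤ 2·#supp u`. [bookkeeping] -/
theorem sum_le_two_mul_card_supp {u : Λ → ℕ} (hu : ∀ g, u g ≤ 2) :
    ∑ g, u g ≤ 2 * (univ.filter (fun g => 1 ≤ u g)).card := by
  rw [card_filter, mul_sum]
  exact sum_le_sum fun g _ => by have := hu g; split_ifs <;> omega

variable {βA βB βC vA vB vC SX SY SW : ℕ} {x y z : Λ → ℕ}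

/-- **`z` full ⇒ small supports of `x, y`** (form B, `three_supports_le_of_full`). [original] -/
theorem three_supports_le_of_full_W (hB : FormOKG Λ 3 βB vB SX SY SW x y z) (hz : ∃ g, z g = 3) :
    (univ.filter (fun g => 1 ≤ x g)).card + (univ.filter (fun g => 1 ≤ y g)).card ≤ Fintype.card Λ + 3 * βB := by
  obtain ⟨c, hc⟩ := hz
  exact three_supports_le_of_full hB hc

/-- **`y` full ⇒ small supports of `z, x`** (form A `−Z′, X → −Y`, re-indexed along `g ↦ −g`). [original] -/
theorem three_supports_le_of_full_Y
    (hA : FormOKG Λ 3 βA vA SW SX SY (fun g => z (-g)) x (fun g => y (-g))) (hy : ∃ g, y g = 3) :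
    (univ.filter (fun g => 1 ≤ z g)).card + (univ.filter (fun g => 1 ≤ x g)).card ≤ Fintype.card Λ + 3 * βA := by
  obtain ⟨c, hc⟩ := hy
  have h := three_supports_le_of_full hA (c := -c) (by rw [neg_neg]; exact hc)
  rw [card_filter_comp_neg z (fun n => 1 ≤ n)] at h
  exact h

/-- **`x` full ⇒ small supports of `y, z`** (form C `Y, −Z′ → −X`, re-indexed along `g ↦ −g`). [original] -/
theorem three_supports_le_of_full_X
    (hC : FormOKG Λ 3 βC vC SY SW SX y (fun g => z (-g)) (fun g => x (-g))) (hx : ∃ g, x g = 3) :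
    (univ.filter (fun g => 1 ≤ y g)).card + (univ.filter (fun g => 1 ≤ z g)).card ≤ Fintype.card Λ + 3 * βC := by
  obtain ⟨c, hc⟩ := hx
  have h := three_supports_le_of_full hC (c := -c) (by rw [neg_neg]; exact hc)
  rw [card_filter_comp_neg z (fun n => 1 ≤ n)] at h
  exact h

/-- **Two-letter structure theorem for FP3.**  Under the three letter forms at `p = 3` with `q = |Λ| < S_W`, `2q + 6β_B < S_X + S_Y`,
`2q + 6β_A < S_X + S_W`, `2q + 6β_C < S_Y + S_W`, at least two of the three letters `x, y, z` have a full class (value `3`). [original] -/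
theorem three_two_letters_full
    (hB : FormOKG Λ 3 βB vB SX SY SW x y z)
    (hA : FormOKG Λ 3 βA vA SW SX SY (fun g => z (-g)) x (fun g => y (-g)))
    (hC : FormOKG Λ 3 βC vC SY SW SX y (fun g => z (-g)) (fun g => x (-g)))
    (hq : Fintype.card Λ < SW) (hXY : 2 * Fintype.card Λ + 6 * βB < SX + SY)
    (hXW : 2 * Fintype.card Λ + 6 * βA < SX + SW) (hYW : 2 * Fintype.card Λ + 6 * βC < SY + SW) :
    ((∃ g, x g = 3) ∧ ∃ g, y g = 3) ∨ ((∃ g, x g = 3) ∧ ∃ g, z g = 3) ∨ ((∃ g, y g = 3) ∧ ∃ g, z g = 3) := by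
  have hx3 : ∀ g, x g ≤ 3 := hB.2.2.2.1
  have hy3 : ∀ g, y g ≤ 3 := hB.2.2.2.2.1
  have hz3 : ∀ g, z g ≤ 3 := fun g => three_target_le hB g
  have hsx : ∑ g, x g = SX := hB.1
  have hsy : ∑ g, y g = SY := hB.2.1
  have hsz : ∑ g, z g = SW := hB.2.2.1
  -- a letter without a full class is `{0,1,2}`-valued, hence supported on at least half its mass
  have two_of : ∀ (u : Λ → ℕ), (∀ g, u g ≤ 3) → (¬ ∃ g, u g = 3) → ∀ g, u g ≤ 2 := fun u hu hn g => by
    have := hu g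
    have : u g ≠ 3 := fun h => hn ⟨g, h⟩
    omega
  by_cases hx : ∃ g, x g = 3 <;> by_cases hy : ∃ g, y g = 3 <;> by_cases hz : ∃ g, z g = 3
  · exact Or.inl ⟨hx, hy⟩
  · exact Or.inl ⟨hx, hy⟩
  · exact Or.inr (Or.inl ⟨hx, hz⟩)
  · -- only `x` full: `y, z ≤ 2`, and form C bounds `#supp y + #supp z`
    exfalso
    have h := three_supports_le_of_full_X hC hx
    have h1 := sum_le_two_mul_card_supp (two_of y hy3 hy)
    have h2 := sum_le_two_mul_card_supp (two_of z hz3 hz)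
    omega
  · exact Or.inr (Or.inr ⟨hy, hz⟩)
  · -- only `y` full
    exfalso
    have h := three_supports_le_of_full_Y hA hy
    have h1 := sum_le_two_mul_card_supp (two_of z hz3 hz)
    have h2 := sum_le_two_mul_card_supp (two_of x hx3 hx)
    omega
  · -- only `z` full
    exfalso
    have h := three_supports_le_of_full_W hB hz
    have h1 := sum_le_two_mul_card_supp (two_of x hx3 hx)
    have h2 := sum_le_two_mul_card_supp (two_of y hy3 hy)
    omega
  · -- no full class at all: `three_exists_full`
    exfalso
    obtain ⟨g, h | h | h⟩ := three_exists_full hB hq (by omega)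
    · exact hx ⟨g, h⟩
    · exact hy ⟨g, h⟩
    · exact hz ⟨g, h⟩

/-! ### Read on `AdmG` at `M = 3·|Λ|` -/

variable {N : ℕ}

/-- **Structure of every FP3-admissible split.**  If `AdmG Λ M a b c` holds at `M = 3·|Λ|` and the shape data satisfy `|Λ| < Σ c a`,
`2|Λ| + 6·max b < Σ a b + Σ b c`, `2|Λ| + 6·max a < Σ a b + Σ c a`, `2|Λ| + 6·max c < Σ b c + Σ c a`, then the admissible class counts
`(x, y, z)` it provides pass the three forms and have full classes in at least TWO letters — hence (by `three_supports_le_of_full_*`) two of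
the three support sums are at most `|Λ| + 3·cap`. [original] -/
theorem admG_three_structure {M : ℕ} {a b c : Fin N → ℕ} (hAdm : AdmG Λ M a b c) (hM : M = Fintype.card Λ * 3)
    (hq : Fintype.card Λ < pCA a b c) (hXY : 2 * Fintype.card Λ + 6 * univ.sup b < pAB a b c + pBC a b c)
    (hXW : 2 * Fintype.card Λ + 6 * univ.sup a < pAB a b c + pCA a b c)
    (hYW : 2 * Fintype.card Λ + 6 * univ.sup c < pBC a b c + pCA a b c) :
    ∃ x y z : Λ → ℕ,
      FormOKG Λ 3 (univ.sup b) 0 (pAB a b c) (pBC a b c) (pCA a b c) x y z ∧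
      FormOKG Λ 3 (univ.sup a) 0 (pCA a b c) (pAB a b c) (pBC a b c) (fun g => z (-g)) x (fun g => y (-g)) ∧
      FormOKG Λ 3 (univ.sup c) 0 (pBC a b c) (pCA a b c) (pAB a b c) y (fun g => z (-g)) (fun g => x (-g)) ∧
      (((∃ g, x g = 3) ∧ ∃ g, y g = 3) ∨ ((∃ g, x g = 3) ∧ ∃ g, z g = 3) ∨ ((∃ g, y g = 3) ∧ ∃ g, z g = 3)) := by
  obtain ⟨x, y, z, hB, hA, hC⟩ :=
    hAdm 3 hM Nat.prime_three 0 0 0 (fun _ => Nat.zero_le _) (fun _ => Nat.zero_le _) (fun _ => Nat.zero_le _)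
  exact ⟨x, y, z, hB, hA, hC, three_two_letters_full hB hA hC hq hXY hXW hYW⟩

/-! ### Instances: the T_B wall list at `7128 = 3·2376` and `(7,7,7)⁵` at `648 = 3·216` -/

/-- **T_B wall list of record at `7128 = 2³·3⁴·11`** (`(14,17,18)+(16,16,16)⁸+(14,15,15)`, quartet-alive witness
`QuartetWall.quartetHypotheses_hold_at_7128`): for EVERY label group `Λ` of order `2376` (all nine abelian groups of that order occur as
quotients `H ⧸ P`, `|P| = 3`), every FP3-admissible split has full classes in two letters.  The four numeric hypotheses
(`2376 < 2510`, `4752 + 102 < 5075`, `4752 + 96 < 5006`, `4752 + 108 < 5089`) are discharged by `decide`. [original] -/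
theorem tb7128_three_structure (hcard : Fintype.card Λ = 2376)
    (hAdm : AdmG Λ 7128 (![14, 16, 16, 16, 16, 16, 16, 16, 16, 14] : Fin 10 → ℕ)
      ![17, 16, 16, 16, 16, 16, 16, 16, 16, 15] ![18, 16, 16, 16, 16, 16, 16, 16, 16, 15]) :
    ∃ x y z : Λ → ℕ,
      FormOKG Λ 3 17 0 2496 2579 2510 x y z ∧
      FormOKG Λ 3 16 0 2510 2496 2579 (fun g => z (-g)) x (fun g => y (-g)) ∧
      FormOKG Λ 3 18 0 2579 2510 2496 y (fun g => z (-g)) (fun g => x (-g)) ∧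
      (((∃ g, x g = 3) ∧ ∃ g, y g = 3) ∨ ((∃ g, x g = 3) ∧ ∃ g, z g = 3) ∨ ((∃ g, y g = 3) ∧ ∃ g, z g = 3)) := by
  have h := admG_three_structure hAdm (by rw [hcard]) (by rw [hcard]; decide) (by rw [hcard]; decide) (by rw [hcard]; decide)
    (by rw [hcard]; decide)
  have e1 : univ.sup (![17, 16, 16, 16, 16, 16, 16, 16, 16, 15] : Fin 10 → ℕ) = 17 := by decide
  have e2 : univ.sup (![14, 16, 16, 16, 16, 16, 16, 16, 16, 14] : Fin 10 → ℕ) = 16 := by decide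
  have e3 : univ.sup (![18, 16, 16, 16, 16, 16, 16, 16, 16, 15] : Fin 10 → ℕ) = 18 := by decide
  have e4 : pAB (![14, 16, 16, 16, 16, 16, 16, 16, 16, 14] : Fin 10 → ℕ)
      ![17, 16, 16, 16, 16, 16, 16, 16, 16, 15] ![18, 16, 16, 16, 16, 16, 16, 16, 16, 15] = 2496 := by decide
  have e5 : pBC (![14, 16, 16, 16, 16, 16, 16, 16, 16, 14] : Fin 10 → ℕ)
      ![17, 16, 16, 16, 16, 16, 16, 16, 16, 15] ![18, 16, 16, 16, 16, 16, 16, 16, 16, 15] = 2579 := by decide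
  have e6 : pCA (![14, 16, 16, 16, 16, 16, 16, 16, 16, 14] : Fin 10 → ℕ)
      ![17, 16, 16, 16, 16, 16, 16, 16, 16, 15] ![18, 16, 16, 16, 16, 16, 16, 16, 16, 15] = 2510 := by decide
  rw [e1, e2, e3, e4, e5, e6] at h
  exact h

/-- **`(7,7,7)⁵` at `648 = 2³·3⁴`** (the first cube list of the T_E champion family past the sextet; FPQ-NOTE §6 had it as a «wall for the
whole prime-coset family»): for every label group `Λ` of order `216`, every FP3-admissible split has full classes in two letters. [original] -/
theorem te648_three_structure (hcard : Fintype.card Λ = 216)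
    (hAdm : AdmG Λ 648 (![7, 7, 7, 7, 7] : Fin 5 → ℕ) ![7, 7, 7, 7, 7] ![7, 7, 7, 7, 7]) :
    ∃ x y z : Λ → ℕ,
      FormOKG Λ 3 7 0 245 245 245 x y z ∧
      FormOKG Λ 3 7 0 245 245 245 (fun g => z (-g)) x (fun g => y (-g)) ∧
      FormOKG Λ 3 7 0 245 245 245 y (fun g => z (-g)) (fun g => x (-g)) ∧
      (((∃ g, x g = 3) ∧ ∃ g, y g = 3) ∨ ((∃ g, x g = 3) ∧ ∃ g, z g = 3) ∨ ((∃ g, y g = 3) ∧ ∃ g, z g = 3)) := by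
  have h := admG_three_structure hAdm (by rw [hcard]) (by rw [hcard]; decide) (by rw [hcard]; decide) (by rw [hcard]; decide)
    (by rw [hcard]; decide)
  have e1 : univ.sup (![7, 7, 7, 7, 7] : Fin 5 → ℕ) = 7 := by decide
  have e4 : pAB (![7, 7, 7, 7, 7] : Fin 5 → ℕ) ![7, 7, 7, 7, 7] ![7, 7, 7, 7, 7] = 245 := by decide
  have e5 : pBC (![7, 7, 7, 7, 7] : Fin 5 → ℕ) ![7, 7, 7, 7, 7] ![7, 7, 7, 7, 7] = 245 := by decide
  have e6 : pCA (![7, 7, 7, 7, 7] : Fin 5 → ℕ) ![7, 7, 7, 7, 7] ![7, 7, 7, 7, 7] = 245 := by decide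
  rw [e1, e4, e5, e6] at h
  exact h

end FPQ

end Summit.MatrixMultiplication.MatrixMultiplication.Theorems
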